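import Summits.BirchSwinnertonDyer.BirchSwinnertonDyer.Theorems.AlignedTransportAtTwoMainConjectureTransportAlignedAtTwoBuzzardKFour
import HarnessLib

/-!
# Crux C1 `MainConjectureTransportAlignedAtTwo` (stmt-BirchSwinnertonDyer-22296), line `birth`, v24 option «Δ(W₁) > 0, off the Kilford stratum»:
# THE SELECTION STEP AFTER THE TRICHOTOMY (lead att-p1 g9; `--supports 22296`)

THEOREMS ONLY (no `def`, no `sorry`, no named fact); pure algebra; closes nothing; BSD is not proved.

Context. On the residual cell `Δ(W₁) > 0 ∧ Δ(W₁) ∉ ℚ₂²` the g9 parity engine (`…OrdPlusLine`) does not pin the plus functional: Buzzard +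
self-duality still give `dim Λ/𝔪Λ = 2` (`Λ = H₁(X₀(N');ℤ)`), so (att-p4 g11, `…BuzzardKFour.trichotomy_of_dvd_S3`) the mod-2 plus functional
`h = φ̄⁺₂` of the second curve is one of `0, f, g, f + g` where `f = φ̄⁺₁`, `g = φ̄⁻₁` are the plus and minus functionals of the first curve —
but the cusp-negation involution `ι` is trivial on `Λ/𝔪Λ` (rectangular period lattice), so parity alone does not select. This file records the
SELECTION LOGIC that a v24 skeleton would use (`eq_of_trichotomy_of_witnesses`): `h = f` as soon as there are
* an `ι`-INVARIANT cycle `y` with `h y` odd (then `g y = 0` automatically: minus functionals vanish on invariant cycles) — excludes `h = 0`, `h = g`;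
* an `ι`-ANTI-INVARIANT cycle `z` with `g z` odd (then `f z = h z = 0` automatically: plus functionals vanish on anti-invariant cycles) — excludes
  `h = f + g`.
Both witnesses live in the Tate cohomology `Ĥ⁰(C₂; Λ^±) = Λ^{±ι}/(1 ± ι)Λ` (classes of the real ovals of `X₀(N')(ℝ)` and their duals): `(1 ± ι)Λ`
only produces EVEN values. So the `Δ > 0` residual of C1 reduces to a parity statement about the modular parametrisations `X₀(N') → Aᵢ` on the real
ovals of `X₀(N')(ℝ)` (odd degree onto a real component of `A₂(ℝ)`; odd intersection of an anti-invariant class with `φ₁⁻¹(A₁(ℝ))`) — recorded in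
`Cruxes/MainConjectureTransportAlignedAtTwo/Lines/birth-ord-plusline-plan.md` (STATUS 18:45Z) as the recommended next attack; no Galois structure on
`J₀(N')[𝔪]` is needed for it.

References: Darmon–Diamond–Taylor 1995 §4.5; Buzzard 2000 Prop. 2.4; Greenberg–Vatsal 2000 §3 Remark 3.4 (the `±` parts at `p = 2`).
-/

-- justification: the `Summit.BirchSwinnertonDyer.BirchSwinnertonDyer.…` path repeats a component (route-file convention)
set_option linter.dupNamespace false

namespace Summit.BirchSwinnertonDyer.BirchSwinnertonDyer.Theorems.AlignedTransportAtTwoOrdPlusLineSelect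

/-- **Selection after the trichotomy.** If `h ∈ {0, f, g, f + g}` (additive maps to `ℤ/2`), `h y ≠ 0 = g y` for some `y` and
`h z = 0 = f z ≠ g z`… precisely `h z = 0`, `f z = 0`, `g z ≠ 0` for some `z`, then `h = f`. (Intended: `f, g` = plus/minus functionals of `W₁`,
`h` = plus functional of `W₂`, `y` an invariant and `z` an anti-invariant cycle of `H₁(X₀(N');ℤ)`.) [folklore] -/
theorem eq_of_trichotomy_of_witnesses {A : Type*} [AddCommGroup A] {f g h : A →+ ZMod 2}
    (htri : h = 0 ∨ h = f ∨ h = g ∨ h = f + g)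
    {y : A} (hy : h y ≠ 0) (hgy : g y = 0) {z : A} (hz : h z = 0) (hfz : f z = 0) (hgz : g z ≠ 0) : h = f := by
  rcases htri with rfl | rfl | rfl | rfl
  · exact absurd (AddMonoidHom.zero_apply y) hy
  · rfl
  · exact absurd hgy hy
  · rw [AddMonoidHom.add_apply, hfz, zero_add] at hz
    exact absurd hz hgz

/-- **Values on `(1 ± ι)`-images are even**: for an additive `φ : A →+ ℤ` and an additive involution-compatible sign rule `φ (ι x) = ε • φ x`
(`ε = 1`: plus functional, `ε = -1`: minus functional), `φ (x + ι x)` and `φ (x - ι x)` are EVEN — so odd witnesses must come from classes in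
`Λ^{±ι}/(1 ± ι)Λ`. [folklore] -/
theorem even_apply_add_of_apply_involution {A : Type*} [AddCommGroup A] (φ : A →+ ℤ) (ι : A →+ A) {ε : ℤ} (hε : ε = 1 ∨ ε = -1)
    (hφ : ∀ x, φ (ι x) = ε * φ x) (x : A) : Even (φ (x + ι x)) ∧ Even (φ (x - ι x)) := by
  rcases hε with rfl | rfl
  · refine ⟨⟨φ x, ?_⟩, ⟨0, ?_⟩⟩
    · rw [map_add, hφ, one_mul]
    · rw [map_sub, hφ, one_mul, sub_self, add_zero]
  · refine ⟨⟨0, ?_⟩, ⟨φ x, ?_⟩⟩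
    · rw [map_add, hφ, neg_one_mul, add_neg_cancel, add_zero]
    · rw [map_sub, hφ, neg_one_mul, sub_neg_eq_add]

end Summit.BirchSwinnertonDyer.BirchSwinnertonDyer.Theorems.AlignedTransportAtTwoOrdPlusLineSelect
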